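import Literature.AlgebraicGeometry.Modules.SerreTwistOneSectionsUpToUnit
import HarnessLib

/-!
# Generating sections with the same morphism differ by a unit OF THE BASE when `Γ(S, 𝒪_S) → Γ(X, 𝒪_X)` is bijective

Layer `Literature/AlgebraicGeometry/Modules`, namespace `Literature.AlgebraicGeometry.Modules.SerreTwist`.  THEOREMS ONLY (no definition,
no named fact, no instance, no notation, no `sorry`).  Cell `hodgecm-mathlib` (D-0151), floor-0 programme P1, sub-line F-13 (`stub_PL`),
inner target P3, socket (S0) «two frame data of the SAME linear rigidification `ι` differ by ONE unit of the base» ([MumfordFogartyKirwan1994]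
Def. 7.5 / Prop. 7.6: a linear rigidification is a compatible family of local frames up to units of the base).  Sequel of ★
`Modules/SerreTwistOneSectionsUpToUnit` (the unit on `X`); here the unit is pushed down to the base along a morphism `q : X → S` whose
comorphism on global functions is bijective — the Stein property at `⊤`, supplied for abelian schemes by ★
`AbelianSchemeOver.app_bijective_of_isLocallyNoetherian` / `baseChange_appTop_bijective` — so that the consumer's (S0) is this file at
`s j := basisSection e j`, `s' j := basisSection e' j` after `Gr = Gr'` (`pullback.hom_ext`).  Count-neutral capital: HC_CM is proved only
modulo the 7 printed citations until rung 0 closes — nothing here bears on a summit statement.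

* (private) `isUnit_of_isUnit_map_of_bijective` — a bijective ring homomorphism reflects units (bookkeeping).
* **`exists_isUnit_appTop_smul_eq_of_toProj_eq_of_frameSystem`** — Proj form: `s' i = q^♯(u) • s i` with `u ∈ Γ(S, 𝒪_S)ˣ`.
* **`exists_isUnit_appTop_smul_eq_of_homEquiv_pointOfSections_eq`** — the `𝐏(J; S)` form (shape of ★ `IsFrameRigidification`).

## References
* [Hartshorne1977] R. Hartshorne, *Algebraic Geometry* (1977), II Thm. 7.1 (a) (p. 150).
* [MumfordFogartyKirwan1994] D. Mumford, J. Fogarty, F. Kirwan, *Geometric Invariant Theory*, 3rd ed. (1994), Ch. 7 §2 Def. 7.5 (p. 130),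
  Prop. 7.6 (p. 136).
-/

noncomputable section

-- `TopCat.Presheaf`/`Scheme.Modules` are not reducible (as in Mathlib's `AlgebraicGeometry/Modules/Sheaf.lean`).
set_option backward.isDefEq.respectTransparency false

universe u

open CategoryTheory AlgebraicGeometry TopologicalSpace Opposite
open Literature.AlgebraicGeometry.Motives Literature.AlgebraicGeometry.Motives.GeneratingSections
open Literature.AlgebraicGeometry.Morphisms Literature.AlgebraicGeometry.Morphisms.ProjCech

namespace Literature.AlgebraicGeometry.Modules

namespace SerreTwist

/-- A bijective ring homomorphism reflects units: if `f` is bijective and `f a` is a unit then `a` is a unit (the inverse of `f a`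
has a preimage, and `f` is injective). [folklore] -/
private theorem isUnit_of_isUnit_map_of_bijective {R R' : Type*} [CommRing R] [CommRing R'] (f : R →+* R')
    (hf : Function.Bijective f) {a : R} (ha : IsUnit (f a)) : IsUnit a := by
  obtain ⟨w, hw⟩ := ha.exists_right_inv
  obtain ⟨b, rfl⟩ := hf.2 w
  rw [← map_mul, ← map_one f] at hw
  exact IsUnit.of_mul_eq_one _ (hf.1 hw)

section Base

variable {A : Type u} [CommRing A] {r : ℕ} {X S : Scheme.{u}} (q : X ⟶ S) (hq : Function.Bijective q.appTop)
  (f : X ⟶ Spec (.of A)) {E : X.Modules} (F F' : FrameSystem E) (h1 : ∀ x, F.rank x = 1) (h1' : ∀ x, F'.rank x = 1)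
  (s s' : Fin (r + 1) → Γ(E, ⊤))
  (hcov : ⨆ i, ⨆ x, X.basicOpen ((CocycleSections.ofFrameSystem F h1 s).coeff i x) = ⊤)
  (hcov' : ⨆ i, ⨆ x, X.basicOpen ((CocycleSections.ofFrameSystem F' h1' s').coeff i x) = ⊤)

include hq in
/-- **Proj form.  Two generating families with the same morphism `X → 𝐏ʳ_A` differ by a unit OF THE BASE `S`** when
`q^♯ : Γ(S, 𝒪_S) → Γ(X, 𝒪_X)` is bijective (Stein at `⊤`): `s'_i = q^♯(u) • s_i` with `u ∈ Γ(S, 𝒪_S)` invertible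
(★ `exists_isUnit_smul_eq_of_toProj_eq_of_frameSystem` gives the unit on `X`; it descends along the bijection, which reflects units).
[cite: Hartshorne1977, II Thm. 7.1 (a) (p. 150)] [cite: MumfordFogartyKirwan1994, Ch. 7 §2 Def. 7.5 (p. 130)] -/
theorem exists_isUnit_appTop_smul_eq_of_toProj_eq_of_frameSystem
    (h : (ofCocycleSections F.U (CocycleSections.ofFrameSystem F h1 s) hcov).toProj f =
      (ofCocycleSections F'.U (CocycleSections.ofFrameSystem F' h1' s') hcov').toProj f) :
    ∃ u : Γ(S, ⊤), IsUnit u ∧ ∀ i, s' i = q.appTop u • s i := by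
  obtain ⟨v, hv, hs⟩ := exists_isUnit_smul_eq_of_toProj_eq_of_frameSystem f F F' h1 h1' s s' hcov hcov' h
  obtain ⟨u, rfl⟩ := hq.2 v
  exact ⟨u, isUnit_of_isUnit_map_of_bijective q.appTop.hom hq hv, hs⟩

end Base

/-- **`𝐏(J; S)` form.  Two generating families of a rank-one module `E` on `X → S` whose `S`-points of `𝐏(J; S)` coincide differ by a
unit OF THE BASE** when `Γ(S, 𝒪_S) → Γ(X, 𝒪_X)` is bijective — the shape ★ `PolarizedAbelianSchemeWithLevel.IsFrameRigidification` ends in,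
so that two frame data `(F, e)`, `(F', e')` of the same `ι` satisfy `basisSection e' j = π^♯(u) • basisSection e j` with `u ∈ Γ(T, 𝒪_T)ˣ`
([MumfordFogartyKirwan1994] Def. 7.5 / Prop. 7.6, with Stein ★ `AbelianSchemeOver.app_bijective_of_isLocallyNoetherian`).
[cite: Hartshorne1977, II Thm. 7.1 (a) (p. 150)] [cite: MumfordFogartyKirwan1994, Ch. 7 §2 Def. 7.5 (p. 130)] -/
theorem exists_isUnit_appTop_smul_eq_of_homEquiv_pointOfSections_eq {J : Type u} [Finite J] {X S : Scheme.{u}} (q : X ⟶ S)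
    (hq : Function.Bijective q.appTop) {E : X.Modules} (F F' : FrameSystem E) (h1 : ∀ x, F.rank x = 1) (h1' : ∀ x, F'.rank x = 1)
    (s s' : Fin (Nat.card J + 1) → Γ(E, ⊤))
    (hcov : ⨆ i, ⨆ x, X.basicOpen ((CocycleSections.ofFrameSystem F h1 s).coeff i x) = ⊤)
    (hcov' : ⨆ i, ⨆ x, X.basicOpen ((CocycleSections.ofFrameSystem F' h1' s').coeff i x) = ⊤)
    (h : Morphisms.projectiveSpace.homEquiv (ι := J) (Over.mk q)
        (Morphisms.projectiveSpace.pointOfSections (Over.mk q)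
          (ofCocycleSections F.U (CocycleSections.ofFrameSystem F h1 s) hcov)) =
      Morphisms.projectiveSpace.homEquiv (ι := J) (Over.mk q)
        (Morphisms.projectiveSpace.pointOfSections (Over.mk q)
          (ofCocycleSections F'.U (CocycleSections.ofFrameSystem F' h1' s') hcov'))) :
    ∃ u : Γ(S, ⊤), IsUnit u ∧ ∀ i, s' i = q.appTop u • s i := by
  obtain ⟨v, hv, hs⟩ := exists_isUnit_smul_eq_of_homEquiv_pointOfSections_eq q F F' h1 h1' s s' hcov hcov' h
  obtain ⟨u, rfl⟩ := hq.2 v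
  exact ⟨u, isUnit_of_isUnit_map_of_bijective q.appTop.hom hq hv, hs⟩

end SerreTwist

end Literature.AlgebraicGeometry.Modules

end
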